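import Mathlib.Analysis.Fourier.FourierTransform
import Mathlib.MeasureTheory.Integral.Bochner.Set
import Mathlib.MeasureTheory.Measure.Lebesgue.Basic
import Literature.Analysis.Fourier.FractalUncertaintyPrinciple
import HarnessLib

/-!
# Bourgain–Dyatlov 2018, Theorem 4: proved pieces of the printed proof

Topic `Literature/Analysis/Fourier`; companion to `FractalUncertaintyPrinciple.lean`, which states
J. Bourgain, S. Dyatlov, *Spectral gaps without the pressure condition*, Ann. of Math. 187
(2018) 825–867, Theorem 4 (`bourgainDyatlov2018_thm4`, the fractal uncertainty principle for
`δ`-regular sets, `0 ≤ δ < 1`) as a named fact. This file PROVES, sorry-free, the parts of the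
printed proof (BD18 §2.2 and the opening of §3.4) that present-day Mathlib supports:

* `volume_le_of_regularity_witness` — BD18 Lemma 2.7 ("Lebesgue measure of a regular set"),
  in witness form: if `μ` is a regularity measure for `X ⊂ [-α₁, α₁]` on scales `α₀ > 0` to
  `α₁ ≥ α₀` then `μ_L(X) ≤ 6 C_R² (α₁/α₀)^δ α₀ = 6 C_R² α₁^δ α₀^{1-δ}` (the paper prints the
  constant `24 C_R²`; the grid-and-residues count below gives `6 C_R²`).
* `IsRegularSet.volume_le` — the same for `IsRegularSet X δ C_R α₀ α₁`.
* `norm_fourierInv_sq_le_volume_mul`, `setIntegral_norm_fourierInv_sq_le` — the two Hölder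
  steps of BD18 (3.19): `‖f‖_{L²(X)} ≤ √μ_L(X) ‖f‖_∞ ≤ √μ_L(X) ‖f̂‖_{L¹} ≤ √(μ_L(X) μ_L(Y)) ‖f̂‖_{L²}`
  for `f = 𝓕⁻ g`, `g ∈ L²` vanishing off `Y`.
* `bourgainDyatlov2018_thm4_of_lt_half` — **Theorem 4 in the regime `0 ≤ δ < 1/2`**, with
  `β = 1/2 - δ` and `C = 6 C_R²`, exactly as the paper dispatches this case at the start of §3.4
  ("This implies (1.4) for `δ < 1/2` with `β = 1/2 - δ`. Therefore, we henceforth assume that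
  `1/2 ≤ δ < 1`").

Deliberately NOT here (the regime `1/2 ≤ δ < 1`, i.e. the discharge `bourgainDyatlov2018_thm4_holds`):
it rests on the Beurling–Malliavin multiplier theorem (BD18 Thm 5 / Lemma 2.11, cited there from
Beurling–Malliavin 1962 and Mashreghi–Nazarov–Havin 2005), on harmonic-measure estimates for slit
strips (BD18 §2.4, Lemma 3.2) and on an induction on scales (BD18 §3.4); none of the first two has
Mathlib support (no Hardy spaces / outer functions, no harmonic measure or Perron method).
-/

namespace Literature.Analysis.Fourier

open _root_.MeasureTheory Set
open scoped FourierTransform ENNReal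

section RegularSets

variable {X : Set ℝ} {δ C_R α₀ α₁ : ℝ}

/-- **Lebesgue measure of a regular set** (BD18 Lemma 2.7, witness form). If `μ` vanishes off
`X ⊂ [-α₁, α₁]` and satisfies the two regularity inequalities of Definition 1.1 with exponent `δ`
and constant `C_R ≥ 1` for all closed intervals of length in `[α₀, α₁]`, `0 < α₀ ≤ α₁`, then
`μ_L(X) ≤ 6 C_R² (α₁/α₀)^δ α₀`. Proof: the grid intervals `[jα₀, (j+1)α₀]` meeting `X` cover `X`;
each has a `2α₀`-fattening of `μ`-mass `≥ C_R⁻¹ α₀^δ` (it contains an `α₀`-interval centred on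
`X`); fattenings with `j` in a fixed residue mod `3` are disjoint, and `μ(ℝ) ≤ 2 C_R α₁^δ`.
[cite: BourgainDyatlov2018, Lemma 2.7] -/
theorem volume_le_of_regularity_witness (μ : Measure ℝ) (hμX : μ Xᶜ = 0)
    (hμ : ∀ a b : ℝ, a < b → α₀ ≤ b - a → b - a ≤ α₁ →
        μ (Icc a b) ≤ ENNReal.ofReal (C_R * (b - a) ^ δ) ∧
          ((a + b) / 2 ∈ X → ENNReal.ofReal (C_R⁻¹ * (b - a) ^ δ) ≤ μ (Icc a b)))
    (hC : 1 ≤ C_R) (hα₀ : 0 < α₀) (hα : α₀ ≤ α₁) (hX : X ⊆ Icc (-α₁) α₁) :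
    volume X ≤ ENNReal.ofReal (6 * C_R ^ 2 * (α₁ / α₀) ^ δ * α₀) := by
  classical
  have hα₁ : 0 < α₁ := hα₀.trans_le hα
  set ρ : ℝ := α₀ with hρdef
  have hρ : 0 < ρ := hα₀
  set K : ℕ := ⌈α₁ / ρ⌉₊ with hKdef
  set J : ℤ → Set ℝ := fun j => Icc ((j : ℝ) * ρ) (((j : ℝ) + 1) * ρ) with hJdef
  set J' : ℤ → Set ℝ := fun j => Icc ((j : ℝ) * ρ - ρ / 2) ((j : ℝ) * ρ + 3 * ρ / 2) with hJ'def
  set S : Finset ℤ := (Finset.Icc (-(K : ℤ)) K).filter fun j => (X ∩ J j).Nonempty with hSdef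
  -- Step A: the grid intervals meeting `X` cover `X`.
  have hcover : X ⊆ ⋃ j ∈ S, J j := by
    intro x hx
    have hxI : x ∈ Icc (-α₁) α₁ := hX hx
    have hKge : α₁ / ρ ≤ (K : ℝ) := Nat.le_ceil _
    set j : ℤ := ⌊x / ρ⌋ with hjdef
    have hj1 : (j : ℝ) ≤ x / ρ := Int.floor_le _
    have hj2 : x / ρ < (j : ℝ) + 1 := Int.lt_floor_add_one _
    have hxJ : x ∈ J j := by
      simp only [hJdef, mem_Icc]
      constructor
      · calc (j : ℝ) * ρ ≤ (x / ρ) * ρ := by gcongr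
          _ = x := by field_simp
      · calc x = (x / ρ) * ρ := by field_simp
          _ ≤ ((j : ℝ) + 1) * ρ := by gcongr
    have hjS : j ∈ S := by
      simp only [hSdef, Finset.mem_filter, Finset.mem_Icc]
      refine ⟨⟨?_, ?_⟩, ⟨x, hx, hxJ⟩⟩
      · have h1 : ((-(K : ℤ) : ℤ) : ℝ) ≤ x / ρ := by
          have : -α₁ / ρ ≤ x / ρ := by gcongr; exact hxI.1
          push_cast
          rw [neg_div] at this
          linarith
        exact Int.le_floor.mpr h1
      · have h2 : (j : ℝ) ≤ (K : ℤ) := by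
          have : x / ρ ≤ α₁ / ρ := by gcongr; exact hxI.2
          push_cast
          linarith
        exact_mod_cast h2
    exact Set.mem_iUnion₂.mpr ⟨j, hjS, hxJ⟩
  -- Step B: hence `volume X ≤ #S · ρ`.
  have hvolJ : ∀ j, volume (J j) = ENNReal.ofReal ρ := by
    intro j
    simp only [hJdef, Real.volume_Icc]
    congr 1
    ring
  have hvol : volume X ≤ (S.card : ℝ≥0∞) * ENNReal.ofReal ρ := by
    calc volume X ≤ volume (⋃ j ∈ S, J j) := measure_mono hcover
      _ ≤ ∑ j ∈ S, volume (J j) := measure_biUnion_finset_le S J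
      _ = ∑ j ∈ S, ENNReal.ofReal ρ := by simp only [hvolJ]
      _ = (S.card : ℝ≥0∞) * ENNReal.ofReal ρ := by
        rw [Finset.sum_const, nsmul_eq_mul]
  -- Step C1: total mass of `μ`.
  have hmass : μ univ ≤ ENNReal.ofReal (2 * C_R * α₁ ^ δ) := by
    have h1 : μ (Icc (-α₁) 0) ≤ ENNReal.ofReal (C_R * α₁ ^ δ) := by
      have := (hμ (-α₁) 0 (by linarith) (by linarith) (by linarith)).1
      simpa using this
    have h2 : μ (Icc 0 α₁) ≤ ENNReal.ofReal (C_R * α₁ ^ δ) := by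
      have := (hμ 0 α₁ (by linarith) (by linarith) (by linarith)).1
      simpa using this
    have hsub : (univ : Set ℝ) ⊆ (Icc (-α₁) 0 ∪ Icc 0 α₁) ∪ Xᶜ := by
      intro x _
      by_cases hx : x ∈ X
      · left
        have := hX hx
        rcases le_or_gt x 0 with h | h
        · exact Or.inl ⟨this.1, h⟩
        · exact Or.inr ⟨h.le, this.2⟩
      · exact Or.inr hx
    have hnn : 0 ≤ C_R * α₁ ^ δ := by positivity
    calc μ univ ≤ μ ((Icc (-α₁) 0 ∪ Icc 0 α₁) ∪ Xᶜ) := measure_mono hsub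
      _ ≤ μ (Icc (-α₁) 0 ∪ Icc 0 α₁) + μ Xᶜ := measure_union_le _ _
      _ ≤ (μ (Icc (-α₁) 0) + μ (Icc 0 α₁)) + μ Xᶜ := by
        gcongr
        exact measure_union_le _ _
      _ ≤ (ENNReal.ofReal (C_R * α₁ ^ δ) + ENNReal.ofReal (C_R * α₁ ^ δ)) + 0 := by
        gcongr
        exact hμX.le
      _ = ENNReal.ofReal (2 * C_R * α₁ ^ δ) := by
        rw [add_zero, ← ENNReal.ofReal_add hnn hnn]
        congr 1
        ring
  -- Step C2: each grid interval meeting `X` has a fattening of mass `≥ C_R⁻¹ ρ^δ`.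
  have hlow : ∀ j ∈ S, ENNReal.ofReal (C_R⁻¹ * ρ ^ δ) ≤ μ (J' j) := by
    intro j hj
    obtain ⟨x, hxX, hxJ⟩ := (Finset.mem_filter.1 hj).2
    simp only [hJdef, mem_Icc] at hxJ
    have hint := (hμ (x - ρ / 2) (x + ρ / 2) (by linarith) (by simp [hρdef]) (by
      have : x + ρ / 2 - (x - ρ / 2) = ρ := by ring
      rw [this]; exact hα)).2 (by
        have : (x - ρ / 2 + (x + ρ / 2)) / 2 = x := by ring
        rw [this]; exact hxX)
    have hlen : x + ρ / 2 - (x - ρ / 2) = ρ := by ring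
    rw [hlen] at hint
    refine hint.trans (measure_mono ?_)
    simp only [hJ'def]
    apply Icc_subset_Icc <;> linarith
  -- Step C3: within a residue of `j` mod 3 the fattenings are pairwise disjoint.
  have hdisj : ∀ r : ℤ,
      (↑(S.filter fun j => j % 3 = r) : Set ℤ).PairwiseDisjoint J' := by
    intro r j hj j' hj' hne
    have hj3 : j % 3 = r := (Finset.mem_filter.1 hj).2
    have hj'3 : j' % 3 = r := (Finset.mem_filter.1 hj').2
    have hmod : Int.ModEq 3 j j' := hj3.trans hj'3.symm
    obtain ⟨k, hk⟩ := (Int.modEq_iff_dvd.1 hmod)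
    have hk0 : k ≠ 0 := by
      rintro rfl
      apply hne
      omega
    have hkR : ((j' : ℝ) - j) = 3 * (k : ℝ) := by exact_mod_cast hk
    change Disjoint (J' j) (J' j')
    rw [Set.disjoint_left]
    intro y hy hy'
    simp only [hJ'def, mem_Icc] at hy hy'
    rcases lt_or_gt_of_ne hk0 with hk | hk
    · have hk1 : (k : ℝ) ≤ -1 := by
        have : k ≤ -1 := by omega
        exact_mod_cast this
      have : (k : ℝ) * ρ ≤ -ρ := by nlinarith
      nlinarith
    · have hk1 : (1 : ℝ) ≤ k := by exact_mod_cast hk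
      have : ρ ≤ (k : ℝ) * ρ := by nlinarith
      nlinarith
  -- Step C4: counting within a residue.
  have hcardr : ∀ r : ℤ,
      (((S.filter fun j => j % 3 = r).card : ℝ)) ≤ 2 * C_R ^ 2 * (α₁ / ρ) ^ δ := by
    intro r
    set Sr := S.filter fun j => j % 3 = r with hSr
    have hE : (Sr.card : ℝ≥0∞) * ENNReal.ofReal (C_R⁻¹ * ρ ^ δ)
        ≤ ENNReal.ofReal (2 * C_R * α₁ ^ δ) := by
      calc (Sr.card : ℝ≥0∞) * ENNReal.ofReal (C_R⁻¹ * ρ ^ δ)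
            = ∑ j ∈ Sr, ENNReal.ofReal (C_R⁻¹ * ρ ^ δ) := by
              rw [Finset.sum_const, nsmul_eq_mul]
        _ ≤ ∑ j ∈ Sr, μ (J' j) :=
              Finset.sum_le_sum fun j hj => hlow j (Finset.mem_filter.1 hj).1
        _ = μ (⋃ j ∈ Sr, J' j) :=
              (measure_biUnion_finset (hdisj r) fun _ _ => measurableSet_Icc).symm
        _ ≤ μ univ := measure_mono (subset_univ _)
        _ ≤ ENNReal.ofReal (2 * C_R * α₁ ^ δ) := hmass
    have hpos : 0 < C_R⁻¹ * ρ ^ δ := by positivity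
    have hE' : (Sr.card : ℝ) * (C_R⁻¹ * ρ ^ δ) ≤ 2 * C_R * α₁ ^ δ := by
      rw [← ENNReal.ofReal_natCast, ← ENNReal.ofReal_mul (by positivity),
        ENNReal.ofReal_le_ofReal_iff (by positivity)] at hE
      exact hE
    rw [Real.div_rpow hα₁.le hρ.le, mul_div_assoc']
    rw [le_div_iff₀ (Real.rpow_pos_of_pos hρ δ)]
    have hCρ : (Sr.card : ℝ) * ρ ^ δ = C_R * ((Sr.card : ℝ) * (C_R⁻¹ * ρ ^ δ)) := by
      field_simp
    rw [hCρ]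
    calc C_R * ((Sr.card : ℝ) * (C_R⁻¹ * ρ ^ δ)) ≤ C_R * (2 * C_R * α₁ ^ δ) := by
          gcongr
      _ = 2 * C_R ^ 2 * α₁ ^ δ := by ring
  -- Step C5: sum over the three residues.
  have hcard : (S.card : ℝ) ≤ 6 * C_R ^ 2 * (α₁ / ρ) ^ δ := by
    have hmaps : (↑S : Set ℤ).MapsTo (fun j : ℤ => j % 3) (↑({0, 1, 2} : Finset ℤ)) := by
      intro j _
      have h0 : 0 ≤ j % 3 := Int.emod_nonneg j (by norm_num)
      have h1 : j % 3 < 3 := Int.emod_lt_of_pos j (by norm_num)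
      simp only [Finset.coe_insert, Finset.coe_singleton, Set.mem_insert_iff,
        Set.mem_singleton_iff]
      omega
    have := Finset.card_eq_sum_card_fiberwise hmaps
    rw [this]
    rw [Finset.sum_insert (by decide), Finset.sum_insert (by decide), Finset.sum_singleton]
    push_cast
    have h0 := hcardr 0
    have h1 := hcardr 1
    have h2 := hcardr 2
    linarith
  -- Step D: assemble.
  calc volume X ≤ (S.card : ℝ≥0∞) * ENNReal.ofReal ρ := hvol
    _ = ENNReal.ofReal ((S.card : ℝ) * ρ) := by
        rw [← ENNReal.ofReal_natCast, ← ENNReal.ofReal_mul (by positivity)]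
    _ ≤ ENNReal.ofReal (6 * C_R ^ 2 * (α₁ / ρ) ^ δ * ρ) := by
        apply ENNReal.ofReal_le_ofReal
        exact mul_le_mul_of_nonneg_right hcard hρ.le

/-- **Lebesgue measure of a regular set** (BD18 Lemma 2.7): if `X ⊂ [-α₁, α₁]` is `δ`-regular
with constant `C_R ≥ 1` on scales `α₀ > 0` to `α₁ ≥ α₀`, then
`μ_L(X) ≤ 6 C_R² (α₁/α₀)^δ α₀` (`= 6 C_R² α₁^δ α₀^{1-δ}`; the paper prints `24 C_R²`).
[cite: BourgainDyatlov2018, Lemma 2.7] -/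
theorem IsRegularSet.volume_le (h : IsRegularSet X δ C_R α₀ α₁) (hC : 1 ≤ C_R) (hα₀ : 0 < α₀)
    (hα : α₀ ≤ α₁) (hX : X ⊆ Icc (-α₁) α₁) :
    volume X ≤ ENNReal.ofReal (6 * C_R ^ 2 * (α₁ / α₀) ^ δ * α₀) := by
  obtain ⟨-, -, μ, hμX, hμ⟩ := h
  exact volume_le_of_regularity_witness μ hμX hμ hC hα₀ hα hX

/-- A `δ`-regular set (any scales) is nonempty. [cite: BourgainDyatlov2018, Definition 1.1] -/
theorem IsRegularSet.nonempty (h : IsRegularSet X δ C_R α₀ α₁) : X.Nonempty := h.1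

/-- A `δ`-regular set (any scales) is closed. [cite: BourgainDyatlov2018, Definition 1.1] -/
theorem IsRegularSet.isClosed (h : IsRegularSet X δ C_R α₀ α₁) : IsClosed X := h.2.1

/-- A `δ`-regular set is Borel measurable (it is closed). [cite: BourgainDyatlov2018, Definition 1.1] -/
theorem IsRegularSet.measurableSet (h : IsRegularSet X δ C_R α₀ α₁) : MeasurableSet X :=
  h.2.1.measurableSet

end RegularSets

end Literature.Analysis.Fourier

namespace Literature.Analysis.Fourier

open _root_.MeasureTheory Set
open scoped FourierTransform ENNReal

section Analytic

/-- If `g ∈ L²(ℝ)` vanishes off a set `Y` of finite Lebesgue measure then, for every `x`,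
`‖𝓕⁻ g (x)‖² ≤ μ_L(Y) · ∫ ‖g‖²` (sup bound `‖𝓕⁻ g‖_∞ ≤ ‖g‖_{L¹}` and Cauchy–Schwarz on `Y`:
the middle two inequalities of BD18 (3.19)). [cite: BourgainDyatlov2018, §3.4 (3.19)] -/
theorem norm_fourierInv_sq_le_volume_mul {Y : Set ℝ}
    (hYvol : volume Y ≠ ∞) {g : ℝ → ℂ} (hg : MemLp g 2 volume)
    (hgY : ∀ ξ, ξ ∉ Y → g ξ = 0) (x : ℝ) :
    ‖(𝓕⁻ g : ℝ → ℂ) x‖ ^ 2 ≤ (volume Y).toReal * ∫ ξ, ‖g ξ‖ ^ 2 := by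
  haveI : IsFiniteMeasure (volume.restrict Y) := isFiniteMeasure_restrict.2 hYvol
  have h1 : ‖(𝓕⁻ g : ℝ → ℂ) x‖ ≤ ∫ ξ, ‖g ξ‖ :=
    VectorFourier.norm_fourierIntegral_le_integral_norm _ _ _ _ _
  have h2 : ∫ ξ, ‖g ξ‖ = ∫ ξ in Y, ‖g ξ‖ := by
    symm
    apply setIntegral_eq_integral_of_forall_compl_eq_zero
    intro ξ hξ
    simp [hgY ξ hξ]
  have h2' : ∫ ξ, ‖g ξ‖ ^ 2 = ∫ ξ in Y, ‖g ξ‖ ^ 2 := by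
    symm
    apply setIntegral_eq_integral_of_forall_compl_eq_zero
    intro ξ hξ
    simp [hgY ξ hξ]
  have hgY2 : MemLp (fun ξ => ‖g ξ‖) 2 (volume.restrict Y) := (hg.restrict Y).norm
  have h1Y : MemLp (fun _ : ℝ => (1 : ℝ)) 2 (volume.restrict Y) := memLp_const 1
  have h3 : ∫ ξ in Y, ‖g ξ‖ ≤
      (∫ ξ in Y, ‖g ξ‖ ^ 2) ^ (1 / (2 : ℝ)) * (volume Y).toReal ^ (1 / (2 : ℝ)) := by
    have := integral_mul_le_Lp_mul_Lq_of_nonneg Real.HolderConjugate.two_two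
      (f := fun ξ => ‖g ξ‖) (g := fun _ => (1 : ℝ)) (μ := volume.restrict Y)
      (ae_of_all _ fun _ => norm_nonneg _) (ae_of_all _ fun _ => zero_le_one)
      (by simpa using hgY2) (by simpa using h1Y)
    simpa [Measure.real] using this
  have hA : 0 ≤ ∫ ξ in Y, ‖g ξ‖ ^ 2 := integral_nonneg fun _ => by positivity
  have hB : 0 ≤ (volume Y).toReal := ENNReal.toReal_nonneg
  have h4 : (∫ ξ in Y, ‖g ξ‖) ^ 2 ≤ (∫ ξ in Y, ‖g ξ‖ ^ 2) * (volume Y).toReal := by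
    have h0 : 0 ≤ ∫ ξ in Y, ‖g ξ‖ := integral_nonneg fun _ => norm_nonneg _
    calc (∫ ξ in Y, ‖g ξ‖) ^ 2
        ≤ ((∫ ξ in Y, ‖g ξ‖ ^ 2) ^ (1 / (2 : ℝ)) * (volume Y).toReal ^ (1 / (2 : ℝ))) ^ 2 := by
          gcongr
      _ = (∫ ξ in Y, ‖g ξ‖ ^ 2) * (volume Y).toReal := by
          rw [mul_pow, ← Real.sqrt_eq_rpow, ← Real.sqrt_eq_rpow, Real.sq_sqrt hA, Real.sq_sqrt hB]
  calc ‖(𝓕⁻ g : ℝ → ℂ) x‖ ^ 2 ≤ (∫ ξ, ‖g ξ‖) ^ 2 := by gcongr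
    _ = (∫ ξ in Y, ‖g ξ‖) ^ 2 := by rw [h2]
    _ ≤ (∫ ξ in Y, ‖g ξ‖ ^ 2) * (volume Y).toReal := h4
    _ = (volume Y).toReal * ∫ ξ, ‖g ξ‖ ^ 2 := by rw [h2', mul_comm]

/-- The volume bound `‖f‖²_{L²(X)} ≤ μ_L(X) μ_L(Y) ‖g‖²_{L²}` for `f = 𝓕⁻ g`, `g ∈ L²` vanishing
off `Y`, `μ_L(X), μ_L(Y) < ∞` (BD18 (3.19), squared). [cite: BourgainDyatlov2018, §3.4 (3.19)] -/
theorem setIntegral_norm_fourierInv_sq_le {X Y : Set ℝ} (hXvol : volume X ≠ ∞)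
    (hYvol : volume Y ≠ ∞) {g : ℝ → ℂ} (hg : MemLp g 2 volume)
    (hgY : ∀ ξ, ξ ∉ Y → g ξ = 0) :
    ∫ x in X, ‖(𝓕⁻ g : ℝ → ℂ) x‖ ^ 2 ≤
      (volume X).toReal * ((volume Y).toReal * ∫ ξ, ‖g ξ‖ ^ 2) := by
  have hpt := norm_fourierInv_sq_le_volume_mul hYvol hg hgY
  have := norm_setIntegral_le_of_norm_le_const (μ := volume) (s := X)
    (f := fun x => ‖(𝓕⁻ g : ℝ → ℂ) x‖ ^ 2) hXvol.lt_top
    (C := (volume Y).toReal * ∫ ξ, ‖g ξ‖ ^ 2) (fun x _ => by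
      rw [Real.norm_of_nonneg (by positivity)]
      exact hpt x)
  rw [Measure.real, mul_comm] at this
  exact (Real.le_norm_self _).trans this

end Analytic

section SmallDelta

/-- **BD18 Theorem 4 in the regime `δ < 1/2`** (the first paragraph of BD18 §3.4, p. 27:
"This implies (1.4) for `δ < 1/2` with `β = 1/2 - δ`"): the volume bounds
`μ_L(X) ≤ 6 C_R² N^{δ-1}`, `μ_L(Y) ≤ 6 C_R² N^δ` and
`‖f‖_{L²(X)} ≤ √(μ_L(X) μ_L(Y)) ‖f̂‖_{L²}` give the fractal uncertainty principle with
`β = 1/2 - δ` and `C = 6 C_R²`. Same quantifier shape as `bourgainDyatlov2018_thm4`, with the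
hypothesis `δ < 1` strengthened to `δ < 1/2`. [cite: BourgainDyatlov2018, §3.4, (3.19)] -/
theorem bourgainDyatlov2018_thm4_of_lt_half :
    ∀ (δ C_R : ℝ), 0 ≤ δ → δ < 1 / 2 → 1 ≤ C_R →
    ∃ β : ℝ, 0 < β ∧ ∃ C : ℝ, ∀ (N : ℝ), 1 ≤ N →
      ∀ (X Y : Set ℝ), X ⊆ Icc (-1) 1 → Y ⊆ Icc (-N) N →
        IsRegularSet X δ C_R N⁻¹ 1 → IsRegularSet Y δ C_R 1 N →
        ∀ g : ℝ → ℂ, MemLp g 2 volume → (∀ ξ, ξ ∉ Y → g ξ = 0) →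
          ∫ x in X, ‖(𝓕⁻ g : ℝ → ℂ) x‖ ^ 2 ≤
            (C * N ^ (-β)) ^ 2 * ∫ ξ, ‖g ξ‖ ^ 2 := by
  intro δ C_R hδ hδh hC
  refine ⟨1 / 2 - δ, by linarith, 6 * C_R ^ 2, ?_⟩
  intro N hN X Y hX hY hXr hYr g hg hgY
  obtain ⟨-, -, μX, hμXc, hμX⟩ := hXr
  obtain ⟨-, -, μY, hμYc, hμY⟩ := hYr
  have hN0 : 0 < N := by linarith
  have hvolX : volume X ≤ ENNReal.ofReal (6 * C_R ^ 2 * (1 / N⁻¹) ^ δ * N⁻¹) :=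
    volume_le_of_regularity_witness μX hμXc hμX hC (inv_pos.2 hN0) (inv_le_one_of_one_le₀ hN)
      hX
  have hvolY : volume Y ≤ ENNReal.ofReal (6 * C_R ^ 2 * (N / 1) ^ δ * 1) :=
    volume_le_of_regularity_witness μY hμYc hμY hC one_pos hN hY
  rw [one_div, inv_inv] at hvolX
  rw [div_one, mul_one] at hvolY
  have hXfin : volume X ≠ ∞ := ne_top_of_le_ne_top ENNReal.ofReal_ne_top hvolX
  have hYfin : volume Y ≠ ∞ := ne_top_of_le_ne_top ENNReal.ofReal_ne_top hvolY
  have hvolX' : (volume X).toReal ≤ 6 * C_R ^ 2 * N ^ δ * N⁻¹ :=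
    ENNReal.toReal_le_of_le_ofReal (by positivity) hvolX
  have hvolY' : (volume Y).toReal ≤ 6 * C_R ^ 2 * N ^ δ :=
    ENNReal.toReal_le_of_le_ofReal (by positivity) hvolY
  have hI : 0 ≤ ∫ ξ, ‖g ξ‖ ^ 2 := integral_nonneg fun _ => by positivity
  have hpow : N ^ δ * N⁻¹ * N ^ δ = (N ^ (-(1 / 2 - δ))) ^ 2 := by
    rw [← Real.rpow_neg_one N, ← Real.rpow_add hN0, ← Real.rpow_add hN0, ← Real.rpow_natCast,
      ← Real.rpow_mul hN0.le]
    congr 1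
    push_cast
    ring
  calc ∫ x in X, ‖(𝓕⁻ g : ℝ → ℂ) x‖ ^ 2
      ≤ (volume X).toReal * ((volume Y).toReal * ∫ ξ, ‖g ξ‖ ^ 2) :=
        setIntegral_norm_fourierInv_sq_le hXfin hYfin hg hgY
    _ ≤ (6 * C_R ^ 2 * N ^ δ * N⁻¹) * ((6 * C_R ^ 2 * N ^ δ) * ∫ ξ, ‖g ξ‖ ^ 2) := by
        gcongr
    _ = (6 * C_R ^ 2 * N ^ (-(1 / 2 - δ))) ^ 2 * ∫ ξ, ‖g ξ‖ ^ 2 := by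
        rw [mul_pow, ← hpow]
        ring

end SmallDelta

end Literature.Analysis.Fourier

namespace Literature.Analysis.Fourier

open _root_.MeasureTheory Set
open scoped ENNReal

/-! ## Regular sets: the combinatorics of BD18 §2.2 used by the iteration argument (§§3.3–3.4)

Sorry-free versions of the regular-set lemmas of Bourgain–Dyatlov 2018, §2.2, that the proof of
Theorem 4 invokes for `1/2 ≤ δ < 1` (lemma numbers below count the lemma environments of §2 of
the arXiv text 1612.09040 in order; titles as printed):

* `card_mul_le_of_centred_intervals` — the counting device of the proofs of Lemma 2.6 ("The
  missing subinterval property"), Lemma 2.8 ("The small cover property") and Lemma 2.9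
  ("Lebesgue measure of a regular set"): grid cells meeting `X` carry disjoint (mod 3) centred
  intervals of mass `≥ C_R⁻¹ w^δ`.
* `IsRegularSet.affine_image` — Lemma 2.1 ("Affine transformations").
* `IsRegularSet.mono_upper_scale` — Lemma 2.2 ("Increasing the upper scale").
* `IsRegularSet.exists_missing_subinterval` — Lemma 2.6 ("The missing subinterval property"),
  under the hypothesis `6 C_R² L^δ < L`, which `six_mul_sq_mul_rpow_lt` derives from the printed
  choice `L ≥ (3C_R)^{2/(1-δ)}` ((2.7) there).
* `IsRegularSet.exists_missing_child` — Lemma 2.10 ("Each parent is missing a child"), stated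
  on `L`-adic intervals without introducing the tree `V_n(X)`.
* `IsRegularSet.neighbourhood` — Lemma 2.3 ("Neighborhoods"), for integer `T`, proved by a
  discrete average of `4T+1` translates of `μ_X` instead of the printed continuous average
  (constant `10TC_R` instead of `4TC_R`).
-/

/-- **Counting lemma** behind BD18 Lemmas 2.6, 2.8 and 2.9 (§2.2). Let `w > 0` and let
`S ⊂ ℤ` be finite; for each `j ∈ S` let `c j` be a point of the grid cell `[p + jw, p + (j+1)w]`
such that the interval of size `w` centred at `c j` has `μ`-mass `≥ m` and lies in a set `E`
with `μ(E) ≤ B`. Then `#S · m ≤ 3B`: within a residue class of `j` mod `3` the centred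
intervals are pairwise disjoint. [cite: BourgainDyatlov2018, §2.2, proof of Lemma 2.6] -/
theorem card_mul_le_of_centred_intervals {μ : Measure ℝ} {S : Finset ℤ} {c : ℤ → ℝ}
    {p w m B : ℝ} {E : Set ℝ} (hw : 0 < w) (hB : 0 ≤ B)
    (hc : ∀ j ∈ S, p + j * w ≤ c j ∧ c j ≤ p + (j + 1) * w)
    (hm : ∀ j ∈ S, ENNReal.ofReal m ≤ μ (Icc (c j - w / 2) (c j + w / 2)))
    (hE : ∀ j ∈ S, Icc (c j - w / 2) (c j + w / 2) ⊆ E) (hμE : μ E ≤ ENNReal.ofReal B) :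
    (S.card : ℝ) * m ≤ 3 * B := by
  classical
  have hEfin : μ E ≠ ∞ := (hμE.trans_lt ENNReal.ofReal_lt_top).ne
  have hEreal : μ.real E ≤ B := ENNReal.toReal_le_of_le_ofReal hB hμE
  have hIm : ∀ j ∈ S, m ≤ μ.real (Icc (c j - w / 2) (c j + w / 2)) := fun j hj =>
    (ENNReal.ofReal_le_iff_le_toReal (measure_ne_top_of_subset (hE j hj) hEfin)).1 (hm j hj)
  -- within a residue class mod 3 the centred intervals are pairwise disjoint
  have hfar : ∀ a b : ℤ, a ∈ S → b ∈ S → a + 3 ≤ b →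
      Disjoint (Icc (c a - w / 2) (c a + w / 2)) (Icc (c b - w / 2) (c b + w / 2)) := by
    intro a b ha hb hab
    have ha' := (hc a ha).2
    have hb' := (hc b hb).1
    have hab' : ((a : ℝ) + 3) * w ≤ (b : ℝ) * w := by
      have : (a : ℝ) + 3 ≤ b := by exact_mod_cast hab
      exact mul_le_mul_of_nonneg_right this hw.le
    rw [Set.disjoint_left]
    intro x hxa hxb
    have hx1 := hxa.2
    have hx2 := hxb.1
    nlinarith
  have hdisj : ∀ r : ℤ, Set.PairwiseDisjoint (↑(S.filter fun j => j % 3 = r))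
      (fun j => Icc (c j - w / 2) (c j + w / 2)) := by
    intro r j hj j' hj' hne
    rw [Finset.coe_filter] at hj hj'
    obtain ⟨hjS, hjr⟩ := hj
    obtain ⟨hj'S, hj'r⟩ := hj'
    have h3 : j + 3 ≤ j' ∨ j' + 3 ≤ j := by omega
    rcases h3 with h | h
    · exact hfar j j' hjS hj'S h
    · exact (hfar j' j hj'S hjS h).symm
  have hcount : ∀ r : ℤ, ((S.filter fun j => j % 3 = r).card : ℝ) * m ≤ B := by
    intro r
    have hsub : (S.filter fun j => j % 3 = r) ⊆ S := Finset.filter_subset _ _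
    calc ((S.filter fun j => j % 3 = r).card : ℝ) * m
          = ∑ _j ∈ S.filter (fun j => j % 3 = r), m := by rw [Finset.sum_const, nsmul_eq_mul]
      _ ≤ ∑ j ∈ S.filter (fun j => j % 3 = r), μ.real (Icc (c j - w / 2) (c j + w / 2)) :=
            Finset.sum_le_sum fun j hj => hIm j (hsub hj)
      _ = μ.real (⋃ j ∈ S.filter (fun j => j % 3 = r), Icc (c j - w / 2) (c j + w / 2)) :=
            (measureReal_biUnion_finset (hdisj r) (fun _ _ => measurableSet_Icc)
              (fun j hj => measure_ne_top_of_subset (hE j (hsub hj)) hEfin)).symm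
      _ ≤ μ.real E := measureReal_mono (Set.iUnion₂_subset fun j hj => hE j (hsub hj)) hEfin
      _ ≤ B := hEreal
  have hfib := Finset.card_eq_sum_card_fiberwise (s := S) (t := ({0, 1, 2} : Finset ℤ))
    (f := fun j : ℤ => j % 3) (by
      intro j _
      have h0 := Int.emod_nonneg j (by norm_num : (3 : ℤ) ≠ 0)
      have h1 := Int.emod_lt_of_pos j (by norm_num : (0 : ℤ) < 3)
      simp only [Finset.coe_insert, Finset.coe_singleton, Set.mem_insert_iff,
        Set.mem_singleton_iff]
      omega)
  rw [hfib]
  push_cast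
  rw [Finset.sum_mul]
  calc ∑ r ∈ ({0, 1, 2} : Finset ℤ), ((S.filter fun j => j % 3 = r).card : ℝ) * m
        ≤ ∑ _r ∈ ({0, 1, 2} : Finset ℤ), B := Finset.sum_le_sum fun r _ => hcount r
    _ = 3 * B := by
          rw [Finset.sum_const, nsmul_eq_mul]
          have h3 : (({0, 1, 2} : Finset ℤ)).card = 3 := by decide
          rw [h3]
          push_cast
          ring

/-- **Affine images of regular sets** (BD18 Lemma 2.1): if `X` is `δ`-regular with constant
`C_R` on scales `α₀` to `α₁` and `t > 0`, `y ∈ ℝ`, then `y + tX` is `δ`-regular with constant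
`C_R` on scales `tα₀` to `tα₁`, with the measure `μ̃(A) = t^δ μ(t⁻¹(A - y))`.
[cite: BourgainDyatlov2018, Lemma 2.1] -/
theorem IsRegularSet.affine_image {X : Set ℝ} {δ C_R α₀ α₁ : ℝ}
    (hX : IsRegularSet X δ C_R α₀ α₁) {t : ℝ} (ht : 0 < t) (y : ℝ) :
    IsRegularSet ((fun x => y + t * x) '' X) δ C_R (t * α₀) (t * α₁) := by
  obtain ⟨hne, hcl, μ, hμX, hreg⟩ := hX
  set f : ℝ → ℝ := fun x => y + t * x with hf
  set g : ℝ → ℝ := fun x => (x - y) / t with hg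
  have hgf : Function.LeftInverse g f := fun x => by simp [hf, hg, ht.ne']
  have hfg : Function.RightInverse g f := fun x => by
    simp only [hf, hg]; field_simp; ring
  have hfm : Measurable f := (measurable_const.add (measurable_const.mul measurable_id))
  have hgc : Continuous g := (continuous_id.sub continuous_const).div_const t
  have himg : f '' X = g ⁻¹' X := congrFun (Set.image_eq_preimage_of_inverse hgf hfg) X
  have hpre : ∀ a b : ℝ, f ⁻¹' Icc a b = Icc (g a) (g b) := by
    intro a b
    ext x
    simp only [hf, hg, Set.mem_preimage, Set.mem_Icc]
    rw [div_le_iff₀ ht, le_div_iff₀ ht]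
    constructor <;> rintro ⟨h1, h2⟩ <;> constructor <;> linarith
  refine ⟨hne.image f, by rw [himg]; exact hcl.preimage hgc, ENNReal.ofReal (t ^ δ) • μ.map f, ?_, ?_⟩
  · -- support
    rw [Measure.smul_apply, smul_eq_mul]
    refine mul_eq_zero_of_right _ ?_
    rw [himg, Measure.map_apply hfm (hcl.preimage hgc).measurableSet.compl, Set.preimage_compl]
    refine measure_mono_null (fun x hx => ?_) hμX
    simp only [Set.mem_compl_iff, Set.mem_preimage] at hx ⊢
    rwa [hgf x] at hx
  · intro a b hab h₀ h₁
    have hgba : g b - g a = (b - a) / t := by simp only [hg]; field_simp; ring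
    have hgab : g a < g b := by simp only [hg]; exact div_lt_div_of_pos_right (by linarith) ht
    have h₀' : α₀ ≤ g b - g a := by rw [hgba, le_div_iff₀ ht]; linarith
    have h₁' : g b - g a ≤ α₁ := by rw [hgba, div_le_iff₀ ht]; linarith
    have key := hreg (g a) (g b) hgab h₀' h₁'
    have hpow : t ^ δ * (g b - g a) ^ δ = (b - a) ^ δ := by
      rw [hgba, Real.div_rpow (by linarith) ht.le, mul_div_cancel₀]
      exact (Real.rpow_pos_of_pos ht δ).ne'
    rw [Measure.smul_apply, smul_eq_mul, Measure.map_apply hfm measurableSet_Icc, hpre]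
    constructor
    · calc ENNReal.ofReal (t ^ δ) * μ (Icc (g a) (g b))
          ≤ ENNReal.ofReal (t ^ δ) * ENNReal.ofReal (C_R * (g b - g a) ^ δ) :=
            mul_le_mul_of_nonneg_left key.1 zero_le
        _ = ENNReal.ofReal (C_R * (b - a) ^ δ) := by
            rw [← ENNReal.ofReal_mul (Real.rpow_nonneg ht.le δ), ← hpow]; ring_nf
    · intro hmid
      have hmid' : (g a + g b) / 2 ∈ X := by
        obtain ⟨x, hx, hxe⟩ := hmid
        have : g ((a + b) / 2) = x := by rw [← hxe]; exact hgf x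
        have e : g ((a + b) / 2) = (g a + g b) / 2 := by simp only [hg]; field_simp; ring
        rw [← e, this]; exact hx
      calc ENNReal.ofReal (C_R⁻¹ * (b - a) ^ δ)
          = ENNReal.ofReal (t ^ δ) * ENNReal.ofReal (C_R⁻¹ * (g b - g a) ^ δ) := by
            rw [← ENNReal.ofReal_mul (Real.rpow_nonneg ht.le δ), ← hpow]; ring_nf
        _ ≤ ENNReal.ofReal (t ^ δ) * μ (Icc (g a) (g b)) := mul_le_mul_of_nonneg_left (key.2 hmid') zero_le

/-- **Increasing the upper scale** (BD18 Lemma 2.2): a `δ`-regular set with constant `C_R` on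
scales `α₀ ≤ α₁` (`0 < α₀`, `0 ≤ δ ≤ 1`) is `δ`-regular with constant `2TC_R` on scales `α₀` to
`Tα₁`, for every `T ≥ 1`: an interval of size `|I| ∈ (α₁, Tα₁]` is covered by `⌈|I|/α₁⌉ ≤ 2T`
intervals of size `α₁`, and contains the interval of size `α₁` with the same centre.
[cite: BourgainDyatlov2018, Lemma 2.2] -/
theorem IsRegularSet.mono_upper_scale {X : Set ℝ} {δ C_R α₀ α₁ : ℝ}
    (hX : IsRegularSet X δ C_R α₀ α₁) (hδ0 : 0 ≤ δ) (hδ1 : δ ≤ 1) (hC : 0 < C_R)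
    (hα₀ : 0 < α₀) (hα : α₀ ≤ α₁) {T : ℝ} (hT : 1 ≤ T) :
    IsRegularSet X δ (2 * T * C_R) α₀ (T * α₁) := by
  obtain ⟨hne, hcl, μ, hμX, hreg⟩ := hX
  have hα₁ : 0 < α₁ := hα₀.trans_le hα
  refine ⟨hne, hcl, μ, hμX, fun a b hab h₀ h₁ => ?_⟩
  have hba : 0 < b - a := by linarith
  by_cases hsmall : b - a ≤ α₁
  · -- the original bounds, weakened
    have key := hreg a b hab h₀ hsmall
    have hpow : 0 ≤ (b - a) ^ δ := Real.rpow_nonneg hba.le δ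
    constructor
    · refine key.1.trans (ENNReal.ofReal_le_ofReal ?_)
      have : C_R ≤ 2 * T * C_R := by nlinarith
      exact mul_le_mul_of_nonneg_right this hpow
    · intro hmid
      refine (ENNReal.ofReal_le_ofReal ?_).trans (key.2 hmid)
      have : (2 * T * C_R)⁻¹ ≤ C_R⁻¹ := by
        rw [inv_le_inv₀ (by positivity) hC]; nlinarith
      exact mul_le_mul_of_nonneg_right this hpow
  · push Not at hsmall
    constructor
    · -- cover `[a, b]` by `n = ⌈(b-a)/α₁⌉ ≤ 2T` intervals of size `α₁`
      set n : ℕ := ⌈(b - a) / α₁⌉₊ with hn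
      have hn1 : ((b - a) / α₁) ≤ n := Nat.le_ceil _
      have hn2 : (n : ℝ) < (b - a) / α₁ + 1 := Nat.ceil_lt_add_one (by positivity)
      have hnT : (n : ℝ) ≤ 2 * T := by
        have : (b - a) / α₁ ≤ T := by rw [div_le_iff₀ hα₁]; linarith
        linarith
      have hcov : Icc a b ⊆ ⋃ k ∈ Finset.range n, Icc (a + k * α₁) (a + (k + 1) * α₁) := by
        intro x hx
        have hxa : 0 ≤ (x - a) / α₁ := div_nonneg (by linarith [hx.1]) hα₁.le
        set k : ℕ := ⌊(x - a) / α₁⌋₊ with hk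
        have hk1 : (k : ℝ) ≤ (x - a) / α₁ := Nat.floor_le hxa
        have hk2 : (x - a) / α₁ < k + 1 := Nat.lt_floor_add_one _
        rw [le_div_iff₀ hα₁] at hk1
        rw [div_lt_iff₀ hα₁] at hk2
        refine Set.mem_iUnion₂.2 ?_
        by_cases hkn : k < n
        · exact ⟨k, Finset.mem_range.2 hkn, by constructor <;> linarith⟩
        · -- then `x = b` sits in the last interval
          have hn0 : 0 < n := by
            have : (0 : ℝ) < n := lt_of_lt_of_le (div_pos hba hα₁) hn1
            exact_mod_cast this
          refine ⟨n - 1, Finset.mem_range.2 (Nat.sub_lt hn0 one_pos), ?_⟩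
          have hkn' : (n : ℝ) ≤ k := by exact_mod_cast not_lt.1 hkn
          have hn1' : b - a ≤ n * α₁ := by rwa [div_le_iff₀ hα₁] at hn1
          have ecast : ((n - 1 : ℕ) : ℝ) = n - 1 := by
            rw [Nat.cast_sub (Nat.one_le_iff_ne_zero.2 hn0.ne')]; simp
          rw [Set.mem_Icc, ecast]
          constructor <;> nlinarith [hx.1, hx.2]
      calc μ (Icc a b) ≤ μ (⋃ k ∈ Finset.range n, Icc (a + k * α₁) (a + (k + 1) * α₁)) :=
            measure_mono hcov
        _ ≤ ∑ k ∈ Finset.range n, μ (Icc (a + k * α₁) (a + (k + 1) * α₁)) :=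
            measure_biUnion_finset_le _ _
        _ ≤ ∑ _k ∈ Finset.range n, ENNReal.ofReal (C_R * α₁ ^ δ) := by
            refine Finset.sum_le_sum fun k _ => ?_
            have h := (hreg (a + k * α₁) (a + (k + 1) * α₁) (by nlinarith) (by nlinarith)
              (by nlinarith)).1
            have e : a + (k + 1) * α₁ - (a + k * α₁) = α₁ := by ring
            rwa [e] at h
        _ = ENNReal.ofReal (n * (C_R * α₁ ^ δ)) := by
            rw [Finset.sum_const, Finset.card_range, nsmul_eq_mul,
              ENNReal.ofReal_mul (p := (n : ℝ)) (Nat.cast_nonneg n), ENNReal.ofReal_natCast]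
        _ ≤ ENNReal.ofReal (2 * T * C_R * (b - a) ^ δ) := by
            apply ENNReal.ofReal_le_ofReal
            have h1 : α₁ ^ δ ≤ (b - a) ^ δ := Real.rpow_le_rpow hα₁.le hsmall.le hδ0
            calc (n : ℝ) * (C_R * α₁ ^ δ) ≤ (2 * T) * (C_R * (b - a) ^ δ) := by gcongr
              _ = 2 * T * C_R * (b - a) ^ δ := by ring
    · -- the interval of size `α₁` with the same centre
      intro hmid
      set c := (a + b) / 2 with hc
      have key := (hreg (c - α₁ / 2) (c + α₁ / 2) (by linarith) (by linarith) (by linarith)).2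
      have e1 : c + α₁ / 2 - (c - α₁ / 2) = α₁ := by ring
      have e2 : (c - α₁ / 2 + (c + α₁ / 2)) / 2 = c := by ring
      rw [e1, e2] at key
      have hsub : Icc (c - α₁ / 2) (c + α₁ / 2) ⊆ Icc a b := by
        intro x hx
        constructor <;> [linarith [hx.1]; linarith [hx.2]]
      calc ENNReal.ofReal ((2 * T * C_R)⁻¹ * (b - a) ^ δ)
          ≤ ENNReal.ofReal (C_R⁻¹ * α₁ ^ δ) := by
            apply ENNReal.ofReal_le_ofReal
            -- `(b-a)^δ ≤ (T α₁)^δ ≤ T α₁^δ ≤ 2T α₁^δ`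
            have h1 : (b - a) ^ δ ≤ (T * α₁) ^ δ := Real.rpow_le_rpow hba.le h₁ hδ0
            have h2 : (T * α₁) ^ δ = T ^ δ * α₁ ^ δ := Real.mul_rpow (by linarith) hα₁.le
            have h3 : T ^ δ ≤ T := by
              conv_rhs => rw [← Real.rpow_one T]
              exact Real.rpow_le_rpow_of_exponent_le hT hδ1
            have h4 : 0 ≤ α₁ ^ δ := Real.rpow_nonneg hα₁.le δ
            rw [mul_inv, mul_inv]
            have h5 : (b - a) ^ δ ≤ 2 * T * α₁ ^ δ := by nlinarith
            calc 2⁻¹ * T⁻¹ * C_R⁻¹ * (b - a) ^ δ ≤ 2⁻¹ * T⁻¹ * C_R⁻¹ * (2 * T * α₁ ^ δ) := by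
                  gcongr
              _ = C_R⁻¹ * α₁ ^ δ := by field_simp
        _ ≤ μ (Icc (c - α₁ / 2) (c + α₁ / 2)) := key hmid
        _ ≤ μ (Icc a b) := measure_mono hsub

/-- **The missing subinterval property** (BD18 Lemma 2.6, quantitative nowhere density of a
`δ`-regular set with `δ < 1`): let `X` be `δ`-regular with constant `C_R` on scales `α₀` to
`α₁`, and let the natural number `L` satisfy `6 C_R² L^δ < L` (which holds as soon as
`L ≥ (3C_R)^{2/(1-δ)}`, see `IsRegularSet.six_mul_sq_mul_rpow_lt`). If `w ≥ α₀` and `Lw ≤ α₁`,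
then among any `L` consecutive grid intervals `[p + kw, p + (k+1)w]`, `k₀ ≤ k < k₀ + L`, at least
one is disjoint from `X`. Proof as printed: otherwise each carries an interval of size `w`
centred in `X`, of mass `≥ C_R⁻¹ w^δ`, all inside a set of mass `≤ 2 C_R (Lw)^δ`, and the
counting lemma gives `L C_R⁻¹ w^δ ≤ 6 C_R (Lw)^δ`. [cite: BourgainDyatlov2018, Lemma 2.6] -/
theorem IsRegularSet.exists_missing_subinterval {X : Set ℝ} {δ C_R α₀ α₁ : ℝ}
    (hX : IsRegularSet X δ C_R α₀ α₁) (hC : 0 < C_R) {L : ℕ}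
    (hL : 6 * C_R ^ 2 * (L : ℝ) ^ δ < L) {p w : ℝ} (hw : 0 < w) (hw₀ : α₀ ≤ w)
    (hw₁ : L * w ≤ α₁) (k₀ : ℤ) :
    ∃ k : ℤ, k₀ ≤ k ∧ k < k₀ + L ∧ Disjoint X (Icc (p + k * w) (p + (k + 1) * w)) := by
  classical
  obtain ⟨-, -, μ, -, hreg⟩ := hX
  have hL1 : 1 ≤ L := by
    rcases Nat.eq_zero_or_pos L with h | h
    · exfalso
      subst h
      have : (0 : ℝ) ≤ 6 * C_R ^ 2 * ((0 : ℕ) : ℝ) ^ δ := by positivity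
      simp at hL this
      linarith
    · exact h
  have hL1' : (1 : ℝ) ≤ L := by exact_mod_cast hL1
  have hLw : w ≤ L * w := le_mul_of_one_le_left hw.le hL1'
  by_contra hcon
  push Not at hcon
  -- every one of the `L` cells meets `X`: choose a point of `X` in each
  set S : Finset ℤ := Finset.Ico k₀ (k₀ + L) with hS
  have hc : ∀ k ∈ S, ∃ x, x ∈ X ∧ x ∈ Icc (p + k * w) (p + (k + 1) * w) := by
    intro k hk
    rw [hS, Finset.mem_Ico] at hk
    have h := hcon k hk.1 hk.2
    rw [Set.not_disjoint_iff] at h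
    obtain ⟨x, hx1, hx2⟩ := h
    exact ⟨x, hx1, hx2⟩
  choose! c hcX hcI using hc
  -- the enclosing set: two intervals of size `Lw`
  set a : ℝ := p + k₀ * w with ha
  set E : Set ℝ := Icc (a - w / 2) (a - w / 2 + L * w) ∪ Icc (a + w / 2) (a + w / 2 + L * w) with hE
  have hμE : μ E ≤ ENNReal.ofReal (2 * (C_R * (L * w) ^ δ)) := by
    have h1 := (hreg (a - w / 2) (a - w / 2 + L * w) (by linarith) (by linarith) (by linarith)).1
    have h2 := (hreg (a + w / 2) (a + w / 2 + L * w) (by linarith) (by linarith) (by linarith)).1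
    have e1 : a - w / 2 + L * w - (a - w / 2) = L * w := by ring
    have e2 : a + w / 2 + L * w - (a + w / 2) = L * w := by ring
    rw [e1] at h1
    rw [e2] at h2
    calc μ E ≤ μ (Icc (a - w / 2) (a - w / 2 + L * w)) + μ (Icc (a + w / 2) (a + w / 2 + L * w)) :=
          measure_union_le _ _
      _ ≤ ENNReal.ofReal (C_R * (L * w) ^ δ) + ENNReal.ofReal (C_R * (L * w) ^ δ) := add_le_add h1 h2
      _ = ENNReal.ofReal (2 * (C_R * (L * w) ^ δ)) := by
          rw [← ENNReal.ofReal_add (by positivity) (by positivity), two_mul]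
  have hcount := card_mul_le_of_centred_intervals (μ := μ) (S := S) (c := c) (p := p) (w := w)
    (m := C_R⁻¹ * w ^ δ) (B := 2 * (C_R * (L * w) ^ δ)) (E := E) hw (by positivity)
    (fun k hk => ⟨(hcI k hk).1, (hcI k hk).2⟩)
    (fun k hk => by
      have h := (hreg (c k - w / 2) (c k + w / 2) (by linarith) (by linarith) (by linarith)).2
      have e1 : c k + w / 2 - (c k - w / 2) = w := by ring
      have e2 : (c k - w / 2 + (c k + w / 2)) / 2 = c k := by ring
      rw [e1, e2] at h
      exact h (hcX k hk))
    (fun k hk => by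
      have hk' : k₀ ≤ k ∧ k < k₀ + L := by simpa [hS] using hk
      have hk1 : (k₀ : ℝ) ≤ k := by exact_mod_cast hk'.1
      have hk2 : (k : ℝ) + 1 ≤ k₀ + L := by exact_mod_cast hk'.2
      have hk1' : (k₀ : ℝ) * w ≤ k * w := mul_le_mul_of_nonneg_right hk1 hw.le
      have hk2' : ((k : ℝ) + 1) * w ≤ (k₀ + L) * w := mul_le_mul_of_nonneg_right hk2 hw.le
      have hck := hcI k hk
      intro x hx
      -- `x ∈ [a - w/2, a + Lw + w/2]`, which the two intervals cover since `L ≥ 1`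
      have hx1 : a - w / 2 ≤ x := by nlinarith [hx.1, hck.1]
      have hx2 : x ≤ a + w / 2 + L * w := by nlinarith [hx.2, hck.2]
      by_cases hxm : x ≤ a - w / 2 + L * w
      · exact Or.inl ⟨hx1, hxm⟩
      · exact Or.inr ⟨by push Not at hxm; nlinarith, hx2⟩)
    hμE
  -- `#S = L`, so `L C_R⁻¹ w^δ ≤ 6 C_R L^δ w^δ`, contradicting `6 C_R² L^δ < L`
  have hcard : (S.card : ℝ) = L := by
    rw [hS, Int.card_Ico]; simp
  rw [hcard, Real.mul_rpow (by positivity) hw.le] at hcount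
  have hwδ : 0 < w ^ δ := Real.rpow_pos_of_pos hw δ
  have : (L : ℝ) ≤ 6 * C_R ^ 2 * (L : ℝ) ^ δ := by
    have h := mul_le_mul_of_nonneg_right hcount (le_of_lt (mul_pos hC (inv_pos.2 hwδ)))
    have e1 : (L : ℝ) * (C_R⁻¹ * w ^ δ) * (C_R * (w ^ δ)⁻¹) = L := by field_simp
    have e2 : 3 * (2 * (C_R * ((L : ℝ) ^ δ * w ^ δ))) * (C_R * (w ^ δ)⁻¹) = 6 * C_R ^ 2 * (L : ℝ) ^ δ := by
      field_simp; ring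
    rwa [e1, e2] at h
  linarith

/-- The arithmetic behind the choice `L ≥ (3C_R)^{2/(1-δ)}` in BD18 (2.7): for `δ < 1`,
`C_R ≥ 1` and a natural number `L ≥ (3 C_R)^{2/(1-δ)}` one has `6 C_R² L^δ < L` (indeed
`L^{1-δ} ≥ 9 C_R² > 6 C_R²`). [cite: BourgainDyatlov2018, Lemma 2.6, (2.7)] -/
theorem six_mul_sq_mul_rpow_lt {δ C_R : ℝ} (hδ1 : δ < 1) (hC : 1 ≤ C_R) {L : ℕ}
    (hL : (3 * C_R) ^ (2 / (1 - δ)) ≤ (L : ℝ)) : 6 * C_R ^ 2 * (L : ℝ) ^ δ < L := by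
  have h1δ : 0 < 1 - δ := by linarith
  have h3C : (1 : ℝ) ≤ 3 * C_R := by linarith
  have hLpos : (0 : ℝ) < L := lt_of_lt_of_le (Real.rpow_pos_of_pos (by linarith) _) hL
  -- `L^{1-δ} ≥ (3 C_R)^2`
  have hkey : (3 * C_R) ^ (2 : ℝ) ≤ (L : ℝ) ^ (1 - δ) := by
    have h := Real.rpow_le_rpow (by positivity) hL h1δ.le
    rwa [← Real.rpow_mul (by positivity), div_mul_cancel₀ _ h1δ.ne'] at h
  rw [Real.rpow_two] at hkey
  have hexp : δ + (1 - δ) = 1 := by ring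
  have hprod : (L : ℝ) ^ δ * (L : ℝ) ^ (1 - δ) = L := by
    rw [← Real.rpow_add hLpos, hexp, Real.rpow_one]
  have hLδ : 0 < (L : ℝ) ^ δ := Real.rpow_pos_of_pos hLpos δ
  have hC2 : 0 < C_R ^ 2 * (L : ℝ) ^ δ := by positivity
  calc 6 * C_R ^ 2 * (L : ℝ) ^ δ < 9 * C_R ^ 2 * (L : ℝ) ^ δ := by nlinarith
    _ = (L : ℝ) ^ δ * (3 * C_R) ^ 2 := by ring
    _ ≤ (L : ℝ) ^ δ * (L : ℝ) ^ (1 - δ) := mul_le_mul_of_nonneg_left hkey hLδ.le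
    _ = L := hprod

/-- **Each parent is missing a child** (BD18 Lemma 2.10, stated without the tree `V_n(X)` of
BD18 (2.9)): if `X` is `δ`-regular with constant `C_R` on scales `α₀` to `α₁`, `L ≥ 2` is a
base with `6 C_R² L^δ < L` (e.g. `L ≥ (3C_R)^{2/(1-δ)}`), and `α₀ ≤ L^{-(n+1)} ≤ L^{-n} ≤ α₁`,
then every `L`-adic interval `[j/Lⁿ, (j+1)/Lⁿ]` has a child `[k/Lⁿ⁺¹, (k+1)/Lⁿ⁺¹]`,
`Lj ≤ k < Lj + L`, disjoint from `X` (so a vertex of the tree `V_n(X)` has at most `L - 1`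
children in `V_{n+1}(X)`). [cite: BourgainDyatlov2018, Lemma 2.10] -/
theorem IsRegularSet.exists_missing_child {X : Set ℝ} {δ C_R α₀ α₁ : ℝ}
    (hX : IsRegularSet X δ C_R α₀ α₁) (hC : 0 < C_R) {L : ℕ}
    (hL : 6 * C_R ^ 2 * (L : ℝ) ^ δ < L) (n : ℕ) (hn₀ : α₀ ≤ ((L : ℝ) ^ (n + 1))⁻¹)
    (hn₁ : ((L : ℝ) ^ n)⁻¹ ≤ α₁) (j : ℤ) :
    ∃ k : ℤ, L * j ≤ k ∧ k < L * j + L ∧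
      Disjoint X (Icc (k * ((L : ℝ) ^ (n + 1))⁻¹) ((k + 1) * ((L : ℝ) ^ (n + 1))⁻¹)) := by
  have hL0 : (0 : ℝ) < L := by
    rcases Nat.eq_zero_or_pos L with h | h
    · exfalso
      subst h
      have : (0 : ℝ) ≤ 6 * C_R ^ 2 * ((0 : ℕ) : ℝ) ^ δ := by positivity
      simp at hL this
      linarith
    · exact_mod_cast h
  set w : ℝ := ((L : ℝ) ^ (n + 1))⁻¹ with hw
  have hwpos : 0 < w := by positivity
  have hLw : (L : ℝ) * w = ((L : ℝ) ^ n)⁻¹ := by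
    rw [hw, pow_succ]; field_simp
  obtain ⟨k, hk1, hk2, hdisj⟩ := hX.exists_missing_subinterval hC hL (p := 0) hwpos hn₀
    (by rw [hLw]; exact hn₁) (L * j)
  refine ⟨k, hk1, hk2, ?_⟩
  simpa using hdisj

open scoped Pointwise in
/-- **Neighbourhoods of regular sets** (BD18 Lemma 2.3, in a discretely averaged form): if `X` is
`δ`-regular with constant `C_R` on scales `α₀` to `α₁ ≥ 2α₀` (`0 < α₀`, `δ ≤ 1`) and
`T ≥ 1` is an integer, then the neighbourhood `X + [-Tα₀, Tα₀]` is `δ`-regular with constant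
`10 T C_R` on scales `2α₀` to `α₁`. BD18 averages the translates `μ_X(· - y)` over
`y ∈ [-Tα₀, Tα₀]` (constant `4TC_R`); we average over the `4T + 1` translates by
`y = -Tα₀ + iα₀/2`, which avoids product measures and gives the constant `2(4T+1)C_R ≤ 10TC_R`.
The argument is otherwise the printed one: each translate obeys the upper bound, and for an
interval `I` centred at `x₁ = x₀ + v`, `x₀ ∈ X`, `|v| ≤ Tα₀`, the translate by the grid point
`y` with `0 ≤ v - y < α₀/2` contains the interval of size `|I|/2` centred at `x₀`.
[cite: BourgainDyatlov2018, Lemma 2.3] -/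
theorem IsRegularSet.neighbourhood {X : Set ℝ} {δ C_R α₀ α₁ : ℝ}
    (hX : IsRegularSet X δ C_R α₀ α₁) (hδ1 : δ ≤ 1) (hC : 0 < C_R)
    (hα₀ : 0 < α₀) (hα : 2 * α₀ ≤ α₁) {T : ℕ} (hT : 1 ≤ T) :
    IsRegularSet (X + Icc (-(T * α₀)) (T * α₀)) δ (10 * T * C_R) (2 * α₀) α₁ := by
  classical
  obtain ⟨hne, hcl, μ, hμX, hreg⟩ := hX
  have hT' : (1 : ℝ) ≤ T := by exact_mod_cast hT
  set s : ℝ := T * α₀ with hs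
  have hs0 : 0 < s := by positivity
  -- the grid of translates
  set M : ℕ := 4 * T + 1 with hM
  have hM0 : (M : ℝ≥0∞) ≠ 0 := Nat.cast_ne_zero.2 (by omega)
  have hMtop : (M : ℝ≥0∞) ≠ ∞ := ENNReal.natCast_ne_top M
  have hMreal : (M : ℝ) = 4 * T + 1 := by simp [hM]
  set u : ℕ → ℝ := fun i => -s + i * (α₀ / 2) with hu
  have hu_mem : ∀ i ∈ Finset.range M, u i ∈ Icc (-s) s := by
    intro i hi
    have hi' : (i : ℝ) ≤ 4 * T := by
      have := Finset.mem_range.1 hi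
      exact_mod_cast Nat.lt_succ_iff.1 this
    simp only [hu, Set.mem_Icc]
    constructor
    · nlinarith
    · nlinarith
  set μ' : Measure ℝ := (M : ℝ≥0∞)⁻¹ • ∑ i ∈ Finset.range M, μ.map (fun x => x + u i) with hμ'
  have hμ'app : ∀ A : Set ℝ, MeasurableSet A →
      μ' A = (M : ℝ≥0∞)⁻¹ * ∑ i ∈ Finset.range M, μ ((fun x => x + u i) ⁻¹' A) := by
    intro A hA
    simp only [hμ', Measure.smul_apply, smul_eq_mul, Measure.coe_finsetSum, Finset.sum_apply]
    congr 1
    refine Finset.sum_congr rfl fun i _ => ?_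
    exact Measure.map_apply (measurable_add_const _) hA
  have hmeasN : MeasurableSet (X + Icc (-s) s) :=
    (hcl.add_right_of_isCompact isCompact_Icc).measurableSet
  refine ⟨hne.add (nonempty_Icc.2 (by linarith)), hcl.add_right_of_isCompact isCompact_Icc,
    μ', ?_, ?_⟩
  · -- support
    rw [hμ'app _ hmeasN.compl]
    refine mul_eq_zero_of_right _ (Finset.sum_eq_zero fun i hi => ?_)
    refine measure_mono_null (fun x hx => ?_) hμX
    intro hxX
    exact hx (Set.add_mem_add hxX (hu_mem i hi))
  · intro a b hab h₀ h₁
    have hpre : ∀ i, (fun x => x + u i) ⁻¹' Icc a b = Icc (a - u i) (b - u i) := by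
      intro i; ext x; simp [le_sub_iff_add_le]
    rw [hμ'app _ measurableSet_Icc]
    simp_rw [hpre]
    constructor
    · -- upper bound: every translate obeys it
      calc (M : ℝ≥0∞)⁻¹ * ∑ i ∈ Finset.range M, μ (Icc (a - u i) (b - u i))
          ≤ (M : ℝ≥0∞)⁻¹ * ∑ _i ∈ Finset.range M, ENNReal.ofReal (C_R * (b - a) ^ δ) := by
            gcongr with i hi
            have h := (hreg (a - u i) (b - u i) (by linarith) (by linarith) (by linarith)).1
            have e : b - u i - (a - u i) = b - a := by ring
            rwa [e] at h
        _ = ENNReal.ofReal (C_R * (b - a) ^ δ) := by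
            rw [Finset.sum_const, Finset.card_range, nsmul_eq_mul, ← mul_assoc,
              ENNReal.inv_mul_cancel hM0 hMtop, one_mul]
        _ ≤ ENNReal.ofReal (10 * T * C_R * (b - a) ^ δ) := by
            apply ENNReal.ofReal_le_ofReal
            have hpow : 0 ≤ (b - a) ^ δ := Real.rpow_nonneg (by linarith) δ
            have : C_R ≤ 10 * T * C_R := by nlinarith
            exact mul_le_mul_of_nonneg_right this hpow
    · -- lower bound
      intro hmid
      obtain ⟨x₀, hx₀, v, hv, hsum⟩ := hmid
      rw [Set.mem_Icc] at hv
      -- the grid point just below `v`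
      set i : ℕ := ⌊(v + s) / (α₀ / 2)⌋₊ with hi
      have hvs : 0 ≤ (v + s) / (α₀ / 2) := div_nonneg (by linarith) (by linarith)
      have hi1 : (i : ℝ) ≤ (v + s) / (α₀ / 2) := Nat.floor_le hvs
      have hi2 : (v + s) / (α₀ / 2) < i + 1 := Nat.lt_floor_add_one _
      rw [le_div_iff₀ (by linarith)] at hi1
      rw [div_lt_iff₀ (by linarith)] at hi2
      have hiM : i ∈ Finset.range M := by
        rw [Finset.mem_range, hM, Nat.lt_succ_iff]
        have : (i : ℝ) ≤ 4 * T := by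
          have h4 : (v + s) / (α₀ / 2) ≤ 4 * T := by
            rw [div_le_iff₀ (by linarith)]; nlinarith
          exact (Nat.floor_le hvs).trans h4
        exact_mod_cast this
      have hvu1 : 0 ≤ v - u i := by simp only [hu]; linarith
      have hvu2 : v - u i < α₀ / 2 := by simp only [hu]; linarith
      -- the interval of size `(b-a)/2` centred at `x₀` sits inside the `i`-th translate
      set r : ℝ := (b - a) / 4 with hr
      have hr0 : α₀ / 2 ≤ r := by rw [hr]; linarith
      have hx₀c : x₀ = (a + b) / 2 - v := by linarith [hsum]
      have hsub : Icc (x₀ - r) (x₀ + r) ⊆ Icc (a - u i) (b - u i) := by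
        intro x hx
        rw [Set.mem_Icc] at hx ⊢
        constructor <;> nlinarith [hx.1, hx.2]
      have key := (hreg (x₀ - r) (x₀ + r) (by linarith) (by linarith) (by linarith)).2
      have e1 : x₀ + r - (x₀ - r) = 2 * r := by ring
      have e2 : (x₀ - r + (x₀ + r)) / 2 = x₀ := by ring
      rw [e1, e2] at key
      have hterm : ENNReal.ofReal (C_R⁻¹ * (2 * r) ^ δ) ≤ μ (Icc (a - u i) (b - u i)) :=
        (key hx₀).trans (measure_mono hsub)
      -- compare constants: `(10 T C_R)⁻¹ (b-a)^δ ≤ M⁻¹ C_R⁻¹ (2r)^δ`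
      have h2δ : (2 : ℝ) ^ δ ≤ 2 := by
        conv_rhs => rw [← Real.rpow_one 2]
        exact Real.rpow_le_rpow_of_exponent_le (by norm_num) hδ1
      have hba : b - a = 2 * (2 * r) := by rw [hr]; ring
      have h2r : 0 < 2 * r := by linarith
      have hpow : (b - a) ^ δ ≤ 2 * (2 * r) ^ δ := by
        rw [hba, Real.mul_rpow (by norm_num) h2r.le]
        exact mul_le_mul_of_nonneg_right h2δ (Real.rpow_nonneg h2r.le δ)
      have hconst : (10 * T * C_R)⁻¹ * (b - a) ^ δ ≤ (M : ℝ)⁻¹ * (C_R⁻¹ * (2 * r) ^ δ) := by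
        rw [hMreal]
        have h2rδ : 0 ≤ (2 * r) ^ δ := Real.rpow_nonneg h2r.le δ
        have hineq : (10 * T * C_R)⁻¹ * (2 * (2 * r) ^ δ) ≤ (4 * T + 1 : ℝ)⁻¹ * (C_R⁻¹ * (2 * r) ^ δ) := by
          rw [show (10 * T * C_R)⁻¹ * (2 * (2 * r) ^ δ) = (2 * r) ^ δ * (2 / (10 * T * C_R)) by ring,
            show (4 * T + 1 : ℝ)⁻¹ * (C_R⁻¹ * (2 * r) ^ δ) = (2 * r) ^ δ * (1 / ((4 * T + 1) * C_R)) by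
              field_simp]
          refine mul_le_mul_of_nonneg_left ?_ h2rδ
          rw [div_le_div_iff₀ (by positivity) (by positivity)]
          nlinarith
        exact (mul_le_mul_of_nonneg_left hpow (by positivity)).trans hineq
      calc ENNReal.ofReal ((10 * T * C_R)⁻¹ * (b - a) ^ δ)
          ≤ ENNReal.ofReal ((M : ℝ)⁻¹ * (C_R⁻¹ * (2 * r) ^ δ)) := ENNReal.ofReal_le_ofReal hconst
        _ = (M : ℝ≥0∞)⁻¹ * ENNReal.ofReal (C_R⁻¹ * (2 * r) ^ δ) := by
            rw [ENNReal.ofReal_mul (by positivity), ENNReal.ofReal_inv_of_pos (by positivity),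
              ENNReal.ofReal_natCast]
        _ ≤ (M : ℝ≥0∞)⁻¹ * μ (Icc (a - u i) (b - u i)) := mul_le_mul_of_nonneg_left hterm zero_le
        _ ≤ (M : ℝ≥0∞)⁻¹ * ∑ j ∈ Finset.range M, μ (Icc (a - u j) (b - u j)) := by
            gcongr
            exact Finset.single_le_sum (f := fun j => μ (Icc (a - u j) (b - u j)))
              (fun _ _ => zero_le) hiM

end Literature.Analysis.Fourier
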